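import Literature.Analysis.FunctionSpaces.SchauderLocalVariable
import Literature.Analysis.FunctionSpaces.ContDiffHolderLocalization
import Literature.Analysis.FunctionSpaces.ContDiffHolderBilinear
import Mathlib.Geometry.Manifold.PartitionOfUnity
import HarnessLib

/-!
# The Schauder estimate for functions supported in a fixed compact set (Schauder program, C2)

Topic `Literature/Analysis/FunctionSpaces`. From the small-ball estimate `exists_schauder_local`
(part B3) to a fixed compact support `K ⊆ E` by a smooth partition of unity `{ζ_m}` of a
neighbourhood of `K` subordinate to finitely many small balls (Gilbarg–Trudinger 2001, Thm. 6.2,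
proof): for `u ∈ C^{2,α}` with `tsupport u ⊆ K`, `u = ∑ ζ_m u`,
`P(ζ_m u) = ζ_m P u + ∑ aⁱʲ(∂ᵢζ_m ∂ⱼu + ∂ᵢu ∂ⱼζ_m + u ∂ᵢⱼζ_m) + ∑ bˡ u ∂ₗζ_m`, and the small-ball
estimate for each `ζ_m u` give

  `[D²u(e_p,e_q)]_α ≤ C ([Pu]_α + sup|Pu| + sup|Du| + [Du]_α + sup|u| + [u]_α)`,

with `C` depending only on `K`, the ellipticity and the Hölder bounds of the coefficients on
`ρ₁`-balls centred in `K`.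

* `exists_schauder_compact_support` — the statement above.

Census item (2a) of `Literature.Geometry.Riemannian.gurskyViaclovsky_pathOpen_weighted_four`.
Everything is proved; no named facts.

## References

* D. Gilbarg, N. S. Trudinger, *Elliptic Partial Differential Equations of Second Order* (2001),
  Thm. 6.2. [GilbargTrudinger2001]
-/

noncomputable section

open MeasureTheory Filter Topology Function Metric Set
open scoped ENNReal NNReal ContDiff InnerProductSpace RealInnerProductSpace Manifold

namespace Literature.Analysis.FunctionSpaces

/-! ### Generic tools -/

section Generic

variable {E : Type*} [NormedAddCommGroup E] [NormedSpace ℝ E] {F : Type*} [NormedAddCommGroup F]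
  [NormedSpace ℝ F]

/-- A `C¹` function with compact support is bounded and `r`-Hölder (`r ≤ 1`). [folklore] -/
theorem exists_bound_holderWith_of_hasCompactSupport {g : E → F} (hg : ContDiff ℝ 1 g)
    (hgs : HasCompactSupport g) {r : ℝ≥0} (hr : r ≤ 1) :
    ∃ Zs Zh : ℝ≥0, (∀ x, ‖g x‖ ≤ Zs) ∧ HolderWith Zh r g := by
  obtain ⟨C₀, hC₀⟩ := hg.continuous.bounded_above_of_compact_support hgs
  have hDc : Continuous (fderiv ℝ g) := hg.continuous_fderiv (by norm_num)
  obtain ⟨C₁, hC₁⟩ := hDc.bounded_above_of_compact_support (hgs.fderiv ℝ)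
  refine ⟨⟨max C₀ 0, le_max_right _ _⟩, ⟨max C₁ 0, le_max_right _ _⟩ + 2 * ⟨max C₀ 0, le_max_right _ _⟩,
    fun x => (hC₀ x).trans (le_max_left _ _), ?_⟩
  exact holderWith_of_dist_le_mul_of_norm_le hr
    (dist_le_mul_of_norm_fderiv_le (hg.differentiable (by norm_num))
      fun z => (hC₁ z).trans (le_max_left _ _))
    fun x => (hC₀ x).trans (le_max_left _ _)

omit [NormedSpace ℝ E] in
/-- Evaluating a Hölder family of bilinear maps at unit vectors. [folklore] -/
theorem HolderWith.apply_vecCons_two [NormedSpace ℝ E] {D : E → E [×2]→L[ℝ] F} {C r : ℝ≥0}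
    (hD : HolderWith C r D) {v w : E} (hv : ‖v‖ ≤ 1) (hw : ‖w‖ ≤ 1) :
    HolderWith C r (fun x => D x ![v, w]) := by
  refine holderWith_of_dist_le fun x y => ?_
  calc dist (D x ![v, w]) (D y ![v, w]) = ‖(D x - D y) ![v, w]‖ := by
        rw [dist_eq_norm, sub_apply]
    _ ≤ ‖D x - D y‖ * ∏ i, ‖(![v, w] : Fin 2 → E) i‖ := ContinuousMultilinearMap.le_opNorm _ _
    _ ≤ ‖D x - D y‖ * 1 := by
        gcongr
        rw [Fin.prod_univ_two]
        simp only [Matrix.cons_val_zero, Matrix.cons_val_one]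
        exact mul_le_one₀ hv (norm_nonneg _) hw
    _ = dist (D x) (D y) := by rw [mul_one, dist_eq_norm]
    _ ≤ C * dist x y ^ (r : ℝ) := hD.dist_le x y

omit [NormedSpace ℝ F] in
/-- The first derivative of a product of real functions, evaluated. [folklore] -/
theorem fderiv_mul_apply_eq {ζ u : E → ℝ} (hζ : Differentiable ℝ ζ) (hu : Differentiable ℝ u)
    (x v : E) :
    fderiv ℝ (fun y => ζ y * u y) x v = ζ x * fderiv ℝ u x v + u x * fderiv ℝ ζ x v := by
  rw [fderiv_fun_mul (hζ x) (hu x)]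
  simp [smul_eq_mul]

omit [NormedSpace ℝ F] in
/-- **Leibniz for second directional derivatives**:
`D²(ζu)(x)(v,w) = ζ D²u(v,w) + Dζ(v) Du(w) + Du(v) Dζ(w) + u D²ζ(v,w)`. [folklore] -/
theorem iteratedFDeriv_two_mul_apply_eq {ζ u : E → ℝ} (hζ : ContDiff ℝ 2 ζ) (hu : ContDiff ℝ 2 u)
    (x v w : E) :
    iteratedFDeriv ℝ 2 (fun y => ζ y * u y) x ![v, w] =
      ζ x * iteratedFDeriv ℝ 2 u x ![v, w] + fderiv ℝ ζ x v * fderiv ℝ u x w +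
        fderiv ℝ u x v * fderiv ℝ ζ x w + u x * iteratedFDeriv ℝ 2 ζ x ![v, w] := by
  have hζd : Differentiable ℝ ζ := hζ.differentiable (by norm_num)
  have hud : Differentiable ℝ u := hu.differentiable (by norm_num)
  rw [← fderiv_fderiv_apply_eq_iteratedFDeriv_two_real (hζ.mul hu) v w x]
  have h1 : (fun y => fderiv ℝ (fun y => ζ y * u y) y w) =
      fun y => ζ y * fderiv ℝ u y w + u y * fderiv ℝ ζ y w :=
    funext fun y => fderiv_mul_apply_eq hζd hud y w
  rw [h1]
  have hDuw : Differentiable ℝ (fun y => fderiv ℝ u y w) :=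
    ((hu.fderiv_right (m := 1) (by norm_num)).differentiable one_ne_zero).clm_apply
      (differentiable_const _)
  have hDζw : Differentiable ℝ (fun y => fderiv ℝ ζ y w) :=
    ((hζ.fderiv_right (m := 1) (by norm_num)).differentiable one_ne_zero).clm_apply
      (differentiable_const _)
  rw [fderiv_fun_add (f := fun y => ζ y * fderiv ℝ u y w) (g := fun y => u y * fderiv ℝ ζ y w)
      ((hζd x).mul (hDuw x)) ((hud x).mul (hDζw x)),
    add_apply, fderiv_mul_apply_eq hζd hDuw x v,
    fderiv_mul_apply_eq hud hDζw x v, fderiv_fderiv_apply_eq_iteratedFDeriv_two_real hu v w x,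
    fderiv_fderiv_apply_eq_iteratedFDeriv_two_real hζ v w x]
  ring

end Generic

/-! ### The estimate for a fixed compact support -/

section Compact

-- `E : Type` (universe `0`): the product rule of part 5 (`MemContDiffHolder.bilinear`) is stated
-- in universe `0`; the application (`E = ℝ⁴`) lives there.
variable {ι : Type*} [Fintype ι] [DecidableEq ι] {E : Type} [NormedAddCommGroup E]
  [InnerProductSpace ℝ E] [FiniteDimensional ℝ E] [MeasurableSpace E] [BorelSpace E] [Nontrivial E]

/-- **The Schauder estimate for a fixed compact support.** For an orthonormal basis `e`,
`0 < α < 1`, ellipticity `0 < λ`, `Λ`, Hölder bounds `K_a, K_b, K_c`, a compact `K ⊆ E` and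
`ρ₁ > 0` there is `C` such that: for all coefficients `a` (symmetric, `λ`-`Λ`-elliptic, `|a| ≤ K_a`,
`[a]_α ≤ K_a` on every ball `B(y, ρ₁)`, `y ∈ K`), `b`, `c` (likewise with `K_b`, `K_c`) and every
`u ∈ C^{2,α}_b` with `tsupport u ⊆ K`,
`[D²u(e_p, e_q)]_α ≤ C ([Pu]_α + sup|Pu| + sup|Du| + [Du]_α + sup|u| + [u]_α)`,
`P u = ∑ᵢⱼ aⁱʲ D²u(eᵢ,eⱼ) + ∑ₗ bˡ Du(eₗ) + c u`. [cite: GilbargTrudinger2001, Thm. 6.2] -/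
theorem exists_schauder_compact_support (bE : OrthonormalBasis ι ℝ E) {α : ℝ≥0} (hα0 : 0 < α)
    (hα1 : α < 1) {l : ℝ} (hl : 0 < l) (L : ℝ) (Ka Kb Kc : ℝ≥0) {K : Set E} (hK : IsCompact K)
    {ρ₁ : ℝ} (hρ₁ : 0 < ρ₁) :
    ∃ C : ℝ≥0, ∀ (a : ι → ι → E → ℝ) (b : ι → E → ℝ) (c : E → ℝ),
      (∀ i j x, a i j x = a j i x) →
      (∀ y ∈ K, ∀ x ∈ ball y ρ₁, ∀ ξ : ι → ℝ, l * ∑ i, ξ i ^ 2 ≤ ∑ i, ∑ j, a i j x * ξ i * ξ j) →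
      (∀ y ∈ K, ∀ x ∈ ball y ρ₁, ∀ ξ : ι → ℝ, ∑ i, ∑ j, a i j x * ξ i * ξ j ≤ L * ∑ i, ξ i ^ 2) →
      (∀ y ∈ K, ∀ i j, ∀ x ∈ ball y ρ₁, ‖a i j x‖ ≤ Ka) →
      (∀ y ∈ K, ∀ i j, HolderOnWith Ka α (a i j) (ball y ρ₁)) →
      (∀ y ∈ K, ∀ l' x, x ∈ ball y ρ₁ → ‖b l' x‖ ≤ Kb) →
      (∀ y ∈ K, ∀ l', HolderOnWith Kb α (b l') (ball y ρ₁)) →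
      (∀ y ∈ K, ∀ x ∈ ball y ρ₁, ‖c x‖ ≤ Kc) → (∀ y ∈ K, HolderOnWith Kc α c (ball y ρ₁)) →
      ∀ (u : E → ℝ), MemContDiffHolder 2 α u → tsupport u ⊆ K →
      ∀ (CP Ps D1s D1h Us Uh : ℝ≥0),
        HolderWith CP α (fun x => (∑ i, ∑ j, a i j x * iteratedFDeriv ℝ 2 u x ![bE i, bE j]) +
          (∑ l', b l' x * fderiv ℝ u x (bE l')) + c x * u x) →
        (∀ x, ‖(∑ i, ∑ j, a i j x * iteratedFDeriv ℝ 2 u x ![bE i, bE j]) +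
          (∑ l', b l' x * fderiv ℝ u x (bE l')) + c x * u x‖ ≤ Ps) →
        (∀ l' x, ‖fderiv ℝ u x (bE l')‖ ≤ D1s) →
        (∀ l', HolderWith D1h α (fun x => fderiv ℝ u x (bE l'))) →
        (∀ x, ‖u x‖ ≤ Us) → HolderWith Uh α u →
        ∀ p q, HolderWith (C * (CP + Ps + D1s + D1h + Us + Uh)) α
          (fun x => iteratedFDeriv ℝ 2 u x ![bE p, bE q]) := by
  have hα1' : α ≤ 1 := hα1.le
  -- Step 0: the small-ball estimate and the radius
  obtain ⟨ρ₀, hρ₀, Cloc, hloc⟩ := exists_schauder_local bE hα0 hα1 hl L Ka Kb Kc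
  set ρ : ℝ := min ρ₀ ρ₁ with hρdef
  have hρ : 0 < ρ := lt_min hρ₀ hρ₁
  have hρρ₀ : ρ ≤ ρ₀ := min_le_left _ _
  have hρρ₁ : ρ ≤ ρ₁ := min_le_right _ _
  -- Step 1: a finite cover of `K` by `ρ`-balls centred in `K` and a smooth partition of unity
  obtain ⟨t, ht⟩ := hK.elim_finite_subcover (fun y : K => ball (y : E) ρ) (fun _ => isOpen_ball)
    (fun x hx => mem_iUnion.2 ⟨⟨x, hx⟩, mem_ball_self hρ⟩)
  obtain ⟨ζP, hζP⟩ := SmoothPartitionOfUnity.exists_isSubordinate 𝓘(ℝ, E) hK.isClosed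
    (fun m : t => ball (((m : K) : E)) ρ) (fun _ => isOpen_ball)
    (fun x hx => by
      obtain ⟨i, hi⟩ := mem_iUnion.1 (ht hx)
      obtain ⟨hi, hx⟩ := mem_iUnion.1 hi
      exact mem_iUnion_of_mem ⟨i, hi⟩ hx)
  set ζ : t → E → ℝ := fun m => ζP m with hζdef
  have hζs : ∀ m, ContDiff ℝ ∞ (ζ m) := fun m => contMDiff_iff_contDiff.1 (ζP m).contMDiff
  have h3top : ((3 : ℕ) : WithTop ℕ∞) ≤ ((⊤ : ℕ∞) : WithTop ℕ∞) := WithTop.coe_le_coe.mpr le_top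
  have hζ3 : ∀ m, ContDiff ℝ 3 (ζ m) := fun m => (hζs m).of_le (by exact_mod_cast h3top)
  have hζ2 : ∀ m, ContDiff ℝ 2 (ζ m) := fun m => (hζ3 m).of_le (by norm_num)
  have hζt : ∀ m, tsupport (ζ m) ⊆ ball (((m : K) : E)) ρ := fun m => hζP m
  have hζc : ∀ m, HasCompactSupport (ζ m) := fun m =>
    IsCompact.of_isClosed_subset (isCompact_closedBall _ _) (isClosed_tsupport _)
      ((hζt m).trans ball_subset_closedBall)
  have hζsum : ∀ x ∈ K, ∑ m, ζ m x = 1 := fun x hx => by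
    rw [← finsum_eq_sum_of_fintype]
    exact ζP.sum_eq_one hx
  -- Step 2: bounds and Hölder constants of `ζ`, `∂ζ`, `∂²ζ`
  have hDζ : ∀ m (l' : ι), ContDiff ℝ 1 (fun x => fderiv ℝ (ζ m) x (bE l')) ∧
      HasCompactSupport (fun x => fderiv ℝ (ζ m) x (bE l')) := fun m l' =>
    ⟨((hζ2 m).fderiv_right (m := 1) (by norm_num)).clm_apply contDiff_const,
      (hζc m).fderiv_apply (𝕜 := ℝ) (bE l')⟩
  have hD2ζ : ∀ m (i j : ι), ContDiff ℝ 1 (fun x => iteratedFDeriv ℝ 2 (ζ m) x ![bE i, bE j]) ∧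
      HasCompactSupport (fun x => iteratedFDeriv ℝ 2 (ζ m) x ![bE i, bE j]) := fun m i j => by
    have heq : (fun x => iteratedFDeriv ℝ 2 (ζ m) x ![bE i, bE j]) =
        fun x => fderiv ℝ (fun y => fderiv ℝ (ζ m) y (bE j)) x (bE i) :=
      funext fun x => (fderiv_fderiv_apply_eq_iteratedFDeriv_two_real (hζ2 m) (bE i) (bE j) x).symm
    rw [heq]
    exact ⟨((((hζ3 m).fderiv_right (m := 2) (by norm_num)).clm_apply
      contDiff_const).fderiv_right (m := 1) (by norm_num)).clm_apply contDiff_const,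
      ((hζc m).fderiv_apply (𝕜 := ℝ) (bE j)).fderiv_apply (𝕜 := ℝ) (bE i)⟩
  choose Z0s Z0h hZ0 using fun m =>
    exists_bound_holderWith_of_hasCompactSupport ((hζ2 m).of_le (by norm_num)) (hζc m) hα1'
  choose Z1s Z1h hZ1 using fun m l' =>
    exists_bound_holderWith_of_hasCompactSupport (hDζ m l').1 (hDζ m l').2 hα1'
  choose Z2s Z2h hZ2 using fun m i j =>
    exists_bound_holderWith_of_hasCompactSupport (hD2ζ m i j).1 (hD2ζ m i j).2 hα1'
  -- the constant
  set Km : t → ℝ≥0 := fun m => (Z0s m + Z0h m) +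
    (∑ i, ∑ j, Ka * (2 * Z1s m i + Z1h m i + 2 * Z1s m j + Z1h m j + 2 * Z2s m i j + Z2h m i j)) +
    ∑ l', Kb * (Z1h m l' + 2 * Z1s m l') with hKm
  refine ⟨∑ m, Cloc * Km m, ?_⟩
  intro a b c hsymm hlow hup ha0 haH hb0 hbH hc0 hcH u hu2 hsupp CP Ps D1s D1h Us Uh hP hPs hD1s
    hD1h hUs hUh p q
  set X : ℝ≥0 := CP + Ps + D1s + D1h + Us + Uh with hX
  have hu : ContDiff ℝ 2 u := hu2.contDiff
  have hud : Differentiable ℝ u := hu.differentiable (by norm_num)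
  -- Step 3: the estimate for each `w_m = ζ_m u`
  have key : ∀ m : t, HolderWith (Cloc * (Km m * X)) α
      (fun x => iteratedFDeriv ℝ 2 (fun y => ζ m y * u y) x ![bE p, bE q]) := by
    intro m
    set y₀ : E := ((m : K) : E) with hy₀
    have hyK : y₀ ∈ K := (m : K).2
    have hbb : ball y₀ ρ ⊆ ball y₀ ρ₁ := ball_subset_ball hρρ₁
    have hζd : Differentiable ℝ (ζ m) := (hζ2 m).differentiable (by norm_num)
    -- vanishing off the ball
    have hzζ : ∀ x ∉ ball y₀ ρ, ζ m x = 0 := fun x hx =>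
      image_eq_zero_of_notMem_tsupport fun h => hx (hζt m h)
    have hzDζ : ∀ (l' : ι), ∀ x ∉ ball y₀ ρ, fderiv ℝ (ζ m) x (bE l') = 0 := fun l' x hx => by
      rw [fderiv_of_notMem_tsupport ℝ fun h => hx (hζt m h)]; rfl
    have hzD2ζ : ∀ (i j : ι), ∀ x ∉ ball y₀ ρ, iteratedFDeriv ℝ 2 (ζ m) x ![bE i, bE j] = 0 :=
      fun i j x hx => by
        have : x ∉ tsupport (iteratedFDeriv ℝ 2 (ζ m)) := fun h =>
          hx (hζt m (tsupport_iteratedFDeriv_subset 2 h))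
        rw [image_eq_zero_of_notMem_tsupport this]; rfl
    -- the function `w = ζ u` and its regularity
    have hwc : ContDiff ℝ 2 (fun y => ζ m y * u y) := (hζ2 m).mul hu
    have hw_mem' : MemContDiffHolder 2 α (fun y => ContinuousLinearMap.mul ℝ ℝ (ζ m y) (u y)) :=
      MemContDiffHolder.bilinear hα1' (ContinuousLinearMap.mul ℝ ℝ)
        (MemContDiffHolder.of_contDiff_of_hasCompactSupport (hζs m) (hζc m) hα1') hu2
    have hw_mem : MemContDiffHolder 2 α (fun y => ζ m y * u y) := by
      simpa only [ContinuousLinearMap.mul_apply'] using hw_mem'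
    have hw_H : ∀ i j, HolderWith (nnHolderNorm α (iteratedFDeriv ℝ 2 (fun y => ζ m y * u y))) α
        (fun x => iteratedFDeriv ℝ 2 (fun y => ζ m y * u y) x ![bE i, bE j]) := fun i j =>
      HolderWith.apply_vecCons_two hw_mem.memHolder_iteratedFDeriv.holderWith
        (bE.norm_eq_one i).le (bE.norm_eq_one j).le
    have hw_supp : tsupport (fun y => ζ m y * u y) ⊆ ball y₀ ρ :=
      tsupport_mul_subset_left.trans (hζt m)
    -- the three kinds of perturbation terms
    -- (T0) `ζ · P u`
    have hT0 : HolderWith (Z0s m * CP + Z0h m * Ps) α (fun x => ζ m x *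
        ((∑ i, ∑ j, a i j x * iteratedFDeriv ℝ 2 u x ![bE i, bE j]) +
          (∑ l', b l' x * fderiv ℝ u x (bE l')) + c x * u x)) :=
      holderWith_mul_of_eq_zero (s := univ) (fun x _ => (hZ0 m).1 x)
        ((hZ0 m).2.holderOnWith univ) hP hPs (fun x hx => (hx (mem_univ x)).elim)
    -- (T1) `a_ij · h_ij`, `h_ij = ∂ᵢζ ∂ⱼu + ∂ᵢu ∂ⱼζ + u ∂ᵢⱼζ`
    have hT1 : ∀ i j, HolderWith (Ka * ((Z1s m i * D1h + Z1h m i * D1s) +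
        (D1s * Z1h m j + D1h * Z1s m j) + (Us * Z2h m i j + Uh * Z2s m i j)) +
        Ka * (Z1s m i * D1s + D1s * Z1s m j + Us * Z2s m i j)) α
        (fun x => a i j x * (fderiv ℝ (ζ m) x (bE i) * fderiv ℝ u x (bE j) +
          fderiv ℝ u x (bE i) * fderiv ℝ (ζ m) x (bE j) +
          u x * iteratedFDeriv ℝ 2 (ζ m) x ![bE i, bE j])) := by
      intro i j
      have hA : HolderWith (Z1s m i * D1h + Z1h m i * D1s) α
          (fun x => fderiv ℝ (ζ m) x (bE i) * fderiv ℝ u x (bE j)) :=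
        holderWith_mul_of_eq_zero (s := univ) (fun x _ => (hZ1 m i).1 x)
          ((hZ1 m i).2.holderOnWith univ) (hD1h j) (hD1s j) (fun x hx => (hx (mem_univ x)).elim)
      have hB : HolderWith (D1s * Z1h m j + D1h * Z1s m j) α
          (fun x => fderiv ℝ u x (bE i) * fderiv ℝ (ζ m) x (bE j)) :=
        holderWith_mul_of_eq_zero (s := univ) (fun x _ => hD1s i x)
          ((hD1h i).holderOnWith univ) (hZ1 m j).2 (hZ1 m j).1 (fun x hx => (hx (mem_univ x)).elim)
      have hC : HolderWith (Us * Z2h m i j + Uh * Z2s m i j) α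
          (fun x => u x * iteratedFDeriv ℝ 2 (ζ m) x ![bE i, bE j]) :=
        holderWith_mul_of_eq_zero (s := univ) (fun x _ => hUs x)
          (hUh.holderOnWith univ) (hZ2 m i j).2 (hZ2 m i j).1 (fun x hx => (hx (mem_univ x)).elim)
      have hh : HolderWith ((Z1s m i * D1h + Z1h m i * D1s) + (D1s * Z1h m j + D1h * Z1s m j) +
          (Us * Z2h m i j + Uh * Z2s m i j)) α
          (fun x => fderiv ℝ (ζ m) x (bE i) * fderiv ℝ u x (bE j) +
            fderiv ℝ u x (bE i) * fderiv ℝ (ζ m) x (bE j) +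
            u x * iteratedFDeriv ℝ 2 (ζ m) x ![bE i, bE j]) := (hA.add hB).add hC
      have hhs : ∀ x, ‖fderiv ℝ (ζ m) x (bE i) * fderiv ℝ u x (bE j) +
          fderiv ℝ u x (bE i) * fderiv ℝ (ζ m) x (bE j) +
          u x * iteratedFDeriv ℝ 2 (ζ m) x ![bE i, bE j]‖ ≤
          (Z1s m i * D1s + D1s * Z1s m j + Us * Z2s m i j : ℝ≥0) := by
        intro x
        push_cast
        refine (norm_add_le _ _).trans (add_le_add ((norm_add_le _ _).trans (add_le_add ?_ ?_)) ?_)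
        · rw [norm_mul]; exact mul_le_mul ((hZ1 m i).1 x) (hD1s j x) (norm_nonneg _) (NNReal.coe_nonneg _)
        · rw [norm_mul]; exact mul_le_mul (hD1s i x) ((hZ1 m j).1 x) (norm_nonneg _) (NNReal.coe_nonneg _)
        · rw [norm_mul]; exact mul_le_mul (hUs x) ((hZ2 m i j).1 x) (norm_nonneg _) (NNReal.coe_nonneg _)
      have hhz : ∀ x ∉ ball y₀ ρ, fderiv ℝ (ζ m) x (bE i) * fderiv ℝ u x (bE j) +
          fderiv ℝ u x (bE i) * fderiv ℝ (ζ m) x (bE j) +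
          u x * iteratedFDeriv ℝ 2 (ζ m) x ![bE i, bE j] = 0 := fun x hx => by
        rw [hzDζ i x hx, hzDζ j x hx, hzD2ζ i j x hx]; ring
      exact holderWith_mul_of_eq_zero (s := ball y₀ ρ) (fun x hx => ha0 y₀ hyK i j x (hbb hx))
        ((haH y₀ hyK i j).mono hbb) hh hhs hhz
    -- (T2) `b_l · (u ∂ₗζ)`
    have hT2 : ∀ l', HolderWith (Kb * (Us * Z1h m l' + Uh * Z1s m l') + Kb * (Us * Z1s m l')) α
        (fun x => b l' x * (u x * fderiv ℝ (ζ m) x (bE l'))) := by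
      intro l'
      have hh : HolderWith (Us * Z1h m l' + Uh * Z1s m l') α
          (fun x => u x * fderiv ℝ (ζ m) x (bE l')) :=
        holderWith_mul_of_eq_zero (s := univ) (fun x _ => hUs x) (hUh.holderOnWith univ)
          (hZ1 m l').2 (hZ1 m l').1 (fun x hx => (hx (mem_univ x)).elim)
      have hhs : ∀ x, ‖u x * fderiv ℝ (ζ m) x (bE l')‖ ≤ (Us * Z1s m l' : ℝ≥0) := fun x => by
        push_cast; rw [norm_mul]
        exact mul_le_mul (hUs x) ((hZ1 m l').1 x) (norm_nonneg _) (NNReal.coe_nonneg _)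
      have hhz : ∀ x ∉ ball y₀ ρ, u x * fderiv ℝ (ζ m) x (bE l') = 0 := fun x hx => by
        rw [hzDζ l' x hx, mul_zero]
      exact holderWith_mul_of_eq_zero (s := ball y₀ ρ) (fun x hx => hb0 y₀ hyK l' x (hbb hx))
        ((hbH y₀ hyK l').mono hbb) hh hhs hhz
    -- the Hölder constant of `P w`
    set CPm : ℝ≥0 := (Z0s m * CP + Z0h m * Ps) +
      (∑ i, ∑ j, (Ka * ((Z1s m i * D1h + Z1h m i * D1s) + (D1s * Z1h m j + D1h * Z1s m j) +
        (Us * Z2h m i j + Uh * Z2s m i j)) + Ka * (Z1s m i * D1s + D1s * Z1s m j + Us * Z2s m i j))) +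
      ∑ l', (Kb * (Us * Z1h m l' + Uh * Z1s m l') + Kb * (Us * Z1s m l')) with hCPm
    have hPw_exp : HolderWith CPm α (fun x =>
        ζ m x * ((∑ i, ∑ j, a i j x * iteratedFDeriv ℝ 2 u x ![bE i, bE j]) +
          (∑ l', b l' x * fderiv ℝ u x (bE l')) + c x * u x) +
        (∑ i, ∑ j, a i j x * (fderiv ℝ (ζ m) x (bE i) * fderiv ℝ u x (bE j) +
          fderiv ℝ u x (bE i) * fderiv ℝ (ζ m) x (bE j) +
          u x * iteratedFDeriv ℝ 2 (ζ m) x ![bE i, bE j])) +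
        ∑ l', b l' x * (u x * fderiv ℝ (ζ m) x (bE l'))) := by
      have h1 := holderWith_finset_sum (f := fun i x => ∑ j, a i j x *
          (fderiv ℝ (ζ m) x (bE i) * fderiv ℝ u x (bE j) + fderiv ℝ u x (bE i) * fderiv ℝ (ζ m) x (bE j) +
            u x * iteratedFDeriv ℝ 2 (ζ m) x ![bE i, bE j])) Finset.univ fun i _ =>
        holderWith_finset_sum (f := fun j x => a i j x *
          (fderiv ℝ (ζ m) x (bE i) * fderiv ℝ u x (bE j) + fderiv ℝ u x (bE i) * fderiv ℝ (ζ m) x (bE j) +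
            u x * iteratedFDeriv ℝ 2 (ζ m) x ![bE i, bE j])) Finset.univ fun j _ => hT1 i j
      have h2 := holderWith_finset_sum (f := fun l' x => b l' x * (u x * fderiv ℝ (ζ m) x (bE l')))
        Finset.univ fun l' _ => hT2 l'
      exact (hT0.add h1).add h2
    -- `P w` in the standard form
    have hPw_eq : (fun x => (∑ i, ∑ j, a i j x *
          iteratedFDeriv ℝ 2 (fun y => ζ m y * u y) x ![bE i, bE j]) +
        (∑ l', b l' x * fderiv ℝ (fun y => ζ m y * u y) x (bE l')) + c x * (ζ m x * u x)) =
        fun x => ζ m x * ((∑ i, ∑ j, a i j x * iteratedFDeriv ℝ 2 u x ![bE i, bE j]) +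
          (∑ l', b l' x * fderiv ℝ u x (bE l')) + c x * u x) +
        (∑ i, ∑ j, a i j x * (fderiv ℝ (ζ m) x (bE i) * fderiv ℝ u x (bE j) +
          fderiv ℝ u x (bE i) * fderiv ℝ (ζ m) x (bE j) +
          u x * iteratedFDeriv ℝ 2 (ζ m) x ![bE i, bE j])) +
        ∑ l', b l' x * (u x * fderiv ℝ (ζ m) x (bE l')) := by
      funext x
      simp only [iteratedFDeriv_two_mul_apply_eq (hζ2 m) hu, fderiv_mul_apply_eq hζd hud,
        mul_add, Finset.sum_add_distrib, Finset.mul_sum]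
      simp only [mul_comm, mul_left_comm, mul_assoc]
      abel
    have hPw : HolderWith CPm α (fun x => (∑ i, ∑ j, a i j x *
          iteratedFDeriv ℝ 2 (fun y => ζ m y * u y) x ![bE i, bE j]) +
        (∑ l', b l' x * fderiv ℝ (fun y => ζ m y * u y) x (bE l')) + c x * (ζ m x * u x)) := by
      rw [hPw_eq]; exact hPw_exp
    -- the small-ball estimate
    have hest := hloc ρ hρ hρρ₀ a b c y₀ hsymm (fun x hx => hlow y₀ hyK x (hbb hx))
      (fun x hx => hup y₀ hyK x (hbb hx)) (fun i j => (haH y₀ hyK i j).mono hbb)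
      (fun l' x hx => hb0 y₀ hyK l' x (hbb hx)) (fun l' => (hbH y₀ hyK l').mono hbb)
      (fun x hx => hc0 y₀ hyK x (hbb hx)) ((hcH y₀ hyK).mono hbb) (fun y => ζ m y * u y) _ CPm hwc
      hw_H hw_supp hPw p q
    refine hest.mono (mul_le_mul' le_rfl ?_)
    -- `CPm ≤ Km m * X`
    have hCP : CP ≤ X :=
      le_self_add.trans (le_self_add.trans (le_self_add.trans (le_self_add.trans le_self_add)))
    have hPs' : Ps ≤ X :=
      le_add_self.trans (le_self_add.trans (le_self_add.trans (le_self_add.trans le_self_add)))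
    have hD1s' : D1s ≤ X := le_add_self.trans (le_self_add.trans (le_self_add.trans le_self_add))
    have hD1h' : D1h ≤ X := le_add_self.trans (le_self_add.trans le_self_add)
    have hUs' : Us ≤ X := le_add_self.trans le_self_add
    have hUh' : Uh ≤ X := le_add_self
    calc CPm ≤ (Z0s m * X + Z0h m * X) +
        (∑ i, ∑ j, (Ka * ((Z1s m i * X + Z1h m i * X) + (X * Z1h m j + X * Z1s m j) +
          (X * Z2h m i j + X * Z2s m i j)) + Ka * (Z1s m i * X + X * Z1s m j + X * Z2s m i j))) +
        ∑ l', (Kb * (X * Z1h m l' + X * Z1s m l') + Kb * (X * Z1s m l')) := by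
          rw [hCPm]
          gcongr
      _ = Km m * X := by
          have e2 : (∑ i, ∑ j, (Ka * ((Z1s m i * X + Z1h m i * X) + (X * Z1h m j + X * Z1s m j) +
              (X * Z2h m i j + X * Z2s m i j)) + Ka * (Z1s m i * X + X * Z1s m j + X * Z2s m i j))) =
              ∑ i, ∑ j, Ka * (2 * Z1s m i + Z1h m i + 2 * Z1s m j + Z1h m j + 2 * Z2s m i j +
                Z2h m i j) * X :=
            Finset.sum_congr rfl fun i _ => Finset.sum_congr rfl fun j _ => by ring
          have e3 : (∑ l', (Kb * (X * Z1h m l' + X * Z1s m l') + Kb * (X * Z1s m l'))) =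
              ∑ l', Kb * (Z1h m l' + 2 * Z1s m l') * X :=
            Finset.sum_congr rfl fun l' _ => by ring
          rw [e2, e3, hKm]
          simp only [Finset.sum_mul, add_mul]
  -- Step 4: `u = ∑ ζ_m u` and summation
  have hueq : u = fun x => ∑ m, ζ m x * u x := by
    funext x
    by_cases hx : x ∈ K
    · rw [← Finset.sum_mul, hζsum x hx, one_mul]
    · have hu0 : u x = 0 := image_eq_zero_of_notMem_tsupport fun h => hx (hsupp h)
      simp [hu0]
  have hD2eq : (fun x => iteratedFDeriv ℝ 2 u x ![bE p, bE q]) =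
      fun x => ∑ m, iteratedFDeriv ℝ 2 (fun y => ζ m y * u y) x ![bE p, bE q] := by
    funext x
    conv_lhs => rw [hueq]
    rw [iteratedFDeriv_fun_sum_apply fun m _ => (((hζ2 m).mul hu).contDiffAt)]
    simp only [_root_.sum_apply]
  rw [hD2eq]
  refine (holderWith_finset_sum
    (f := fun m x => iteratedFDeriv ℝ 2 (fun y => ζ m y * u y) x ![bE p, bE q]) Finset.univ
    fun m _ => key m).mono (le_of_eq ?_)
  rw [Finset.sum_mul]
  exact Finset.sum_congr rfl fun m _ => by ring

end Compact

end Literature.Analysis.FunctionSpaces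

end
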